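import Literature.AnabelianGeometry.EtaleTheta.ThetaSettingTopology
import HarnessLib

/-!
# [EtTh] §1: `(Δ^tp_Ÿ)^Θ` is compact under the root topology predicate (proof-only)

Mochizuki, *The étale theta function and its Frobenioid-theoretic manifestations*, Publ. RIMS **45** (2009), §1 pp. 12–13
«exact sequence of abelian profinite groups 1 → Δ_Θ → (Δ^tp_Y)^Θ → (Δ^tp_Y)^ell → 1», p. 17 «Ÿ = Y₂»
[cite: MochizukiEtTh2009, §1 p.12]. abc-iut cell, layer L2, seat abc-iut-L2-t1 (§1 ROOT owner). PROOF-ONLY (0 `def`)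
sequel of `ThetaSettingTopology.lean` (census S1-1 `HasThetaTopology`): the compactness of `(Δ^tp_Ÿ)^Θ` — the image of
`Δ^tp_Ÿ = Δ^tp_{Y₂}` in `(Π^tp_X)^Θ`, hypothesis `hcpt` of `Sec1Prop15iiQuotOfStdLog` — FOLLOWS from `HasThetaTopology`:
a topological quotient map of groups is OPEN, so `(Π^tp_{Y₂})^Θ` is an open, hence closed, subgroup, and
`(Δ^tp_Ÿ)^Θ = (Δ^tp_Y)^Θ ∩ (Π^tp_{Y₂})^Θ` (the kernel of `(·)^Θ` lies in `Δ^tp_X`) is closed in the compact `(Δ^tp_Y)^Θ`.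
* `ThetaSetting.dtpYddN_one_eq`, `coe_map_toTheta_dtpYddN_one_eq_inter`, `HasThetaTopology.isCompact_dtpYddTheta`
  (the openness of the quotient homomorphism is proved inline; its L6 twin is `EtaleThetaDataOfSetting.isOpenMap_toTheta`).
HONEST FRAMING: [EtTh] is refereed; nothing here bears on [IUTchIII] Cor. 3.12; typed ≠ proved.
-/

noncomputable section

namespace Literature.AnabelianGeometry.EtaleTheta

open Literature.AnabelianGeometry.SemiGraphs Topology
open scoped Pointwise

namespace ThetaSetting

variable {p : ℕ} [Fact p.Prime] {D : ThetaSetting p}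

/-- `Δ^tp_Ÿ = Δ^tp_{Y₂} = Π^tp_{Y₂} ∩ Δ^tp_X` («Ÿ = Y₂», p. 17; the `G_{J̈₁}`-condition is vacuous on `Δ^tp_X`).
[cite: MochizukiEtTh2009, §1 p.17] -/
theorem dtpYddN_one_eq : D.DtpYddN 1 = D.GtpYN 2 ⊓ D.DeltaTemp := by
  ext x
  constructor
  · rintro ⟨⟨h1, -⟩, h2⟩
    exact ⟨by simpa using h1, h2⟩
  · rintro ⟨h1, h2⟩
    refine ⟨⟨by simpa using h1, ?_⟩, h2⟩
    have hx : D.aug.toMonoidHom x = 1 := h2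
    change D.aug.toMonoidHom x ∈ D.GJddN 1
    rw [hx]
    exact one_mem _

/-- `(Δ^tp_Ÿ)^Θ = (Δ^tp_Y)^Θ ∩ (Π^tp_{Y₂})^Θ` as subsets of `(Π^tp_X)^Θ` (`Ker((·)^Θ) ⊆ Δ^tp_X`).
[cite: MochizukiEtTh2009, §1 p.17] -/
theorem coe_map_toTheta_dtpYddN_one_eq_inter :
    (((D.DtpYddN 1).map D.toTheta : Subgroup D.GtpTheta) : Set D.GtpTheta) =
      ((D.DtpYTheta : Subgroup D.GtpTheta) : Set D.GtpTheta) ∩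
        (((D.GtpYN 2).map D.toTheta : Subgroup D.GtpTheta) : Set D.GtpTheta) := by
  rw [dtpYddN_one_eq]
  ext z
  constructor
  · rintro ⟨g, ⟨hgN, hgΔ⟩, rfl⟩
    exact ⟨⟨g, ⟨D.GtpYN_le 2 hgN, hgΔ⟩, rfl⟩, ⟨g, hgN, rfl⟩⟩
  · rintro ⟨⟨d, ⟨-, hdΔ⟩, hdz⟩, ⟨g, hgN, rfl⟩⟩
    refine ⟨g, ⟨hgN, ?_⟩, rfl⟩
    have hk : d⁻¹ * g ∈ D.toTheta.ker := by
      rw [MonoidHom.mem_ker, map_mul, map_inv, hdz, inv_mul_cancel]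
    have := mul_mem hdΔ (D.ker_toTheta_le_deltaTemp hk)
    rwa [mul_inv_cancel_left] at this

/-- **`(Δ^tp_Ÿ)^Θ` is compact** under the census predicate `HasThetaTopology` (R3 + `(Δ^tp_Y)^Θ` compact): it is the
intersection of the compact `(Δ^tp_Y)^Θ` with the open — hence closed — subgroup `(Π^tp_{Y₂})^Θ` («exact sequence of
abelian profinite groups», p. 12, for `Ÿ`). [cite: MochizukiEtTh2009, §1 p.12] -/
theorem HasThetaTopology.isCompact_dtpYddTheta (h : D.HasThetaTopology) :
    IsCompact ((((D.DtpYddN 1).map D.toTheta : Subgroup D.GtpTheta)) : Set D.GtpTheta) := by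
  rw [coe_map_toTheta_dtpYddN_one_eq_inter]
  refine h.isCompact_dtpYTheta.inter_right (Subgroup.isClosed_of_isOpen _ ?_)
  -- a topological quotient homomorphism is open (the saturation of an open `U` is `U · Ker`); cf. the L6 twin
  -- `EtaleThetaDataOfSetting.isOpenMap_toTheta` (not imported across layers)
  have hq := h.isQuotientMap_toTheta
  change IsOpen (D.toTheta '' (D.GtpYN 2 : Set D.PiTemp))
  rw [← hq.isOpen_preimage]
  have hsat : D.toTheta ⁻¹' (D.toTheta '' (D.GtpYN 2 : Set D.PiTemp)) =
      ((D.GtpYN 2 : Subgroup D.PiTemp) : Set D.PiTemp) * ((D.toTheta.ker : Subgroup D.PiTemp) : Set D.PiTemp) := by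
    ext x
    constructor
    · rintro ⟨u, hu, hux⟩
      refine Set.mem_mul.mpr ⟨u, hu, u⁻¹ * x, ?_, mul_inv_cancel_left u x⟩
      rw [SetLike.mem_coe, MonoidHom.mem_ker, map_mul, map_inv, hux, inv_mul_cancel]
    · intro hx
      obtain ⟨u, hu, k, hk, rfl⟩ := Set.mem_mul.mp hx
      refine ⟨u, hu, ?_⟩
      rw [SetLike.mem_coe, MonoidHom.mem_ker] at hk
      rw [map_mul, hk, mul_one]
  rw [hsat]
  exact (D.isOpen_GtpYN 2).mul_right

end ThetaSetting

end Literature.AnabelianGeometry.EtaleTheta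

end
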